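import Literature.MathematicalPhysics.QuantumFieldTheory.ContinuumLimits
import HarnessLib

/-!
# The unitary-gauge `SU(2)` Yang–Mills–Higgs torus measure is a probability measure

Sibling proof file of `Literature/MathematicalPhysics/QuantumFieldTheory/ContinuumLimits.lean`:
it discharges the named fact
`Literature.MathematicalPhysics.QuantumFieldTheory.isProbabilityMeasure_su2HiggsMeasure` (D-0014)
as `theorem isProbabilityMeasure_su2HiggsMeasure_holds : isProbabilityMeasure_su2HiggsMeasure`,
i.e. for every torus side `L ≥ 1`, gauge coupling `g` and Higgs length `α` the normalised
unitary-gauge `SU(2)` lattice Yang–Mills–Higgs measure `su2HiggsMeasure L g α =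
(su2HiggsWeight L g α univ)⁻¹ • su2HiggsWeight L g α` on `GaugeConfig d L SU2 = (Edge d L → SU(2))`
has total mass `1`.  No statement is introduced or changed here; the one auxiliary declaration
(`withDensity_exp_univ_ne_zero_and_ne_top`, private) is proved.

## Source

S. Chatterjee, *A scaling limit of `SU(2)` lattice Yang–Mills–Higgs theory*, Probab. Math.
Phys. **7** (2026) 339, arXiv:2401.10507 [cite: arXiv240110507]: §1.1 (the lattice theory
"defines a probability measure `dμ = Z⁻¹ e^{S} ∏ₑ dU_e ∏ₓ dφ_x`, where `Z` is the normalizing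
constant, `dU_e` denotes normalized Haar measure"), §1.4 (the `SU(2)` model with fixed-length
Higgs field) and Lemma 5.4 (§5.2: after unitary gauge fixing the law of the gauge field has density
proportional to `exp (g⁻² ∑ₚ Re Tr U_p + (α²/2) ∑ₑ Re Tr U_e)` with respect to product Haar
measure on `SU(2)^E`).  That `0 < Z < ∞` — so that the normalisation makes sense — is implicit in
the source (finite lattice, compact group, bounded continuous density); this file supplies it for the
tree's rendering `su2HiggsWeight` (plaquette coefficient `(2g²)⁻¹`, via Wave 0's `wilsonWeight`,
and edge coefficient `α²/2`; the proof below is insensitive to these constants and to the sign of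
`g`, including the junk value `β = 0` at `g = 0`).

## Proof

* `withDensity_exp_univ_ne_zero_and_ne_top`: on a compact space, a continuous `φ : X → ℝ` has
  `c ≤ φ ≤ C` (`isCompact_range`, `IsCompact.bddBelow/bddAbove`), so for a finite measure `μ`
  with `μ univ ≠ 0` the tilted measure `μ.withDensity (ofReal ∘ exp ∘ φ)` has total mass between
  `e^{c} μ(univ) > 0` and `e^{C} μ(univ) < ∞` (`lintegral_mono`, `lintegral_const`).
* `isProbabilityMeasure_su2HiggsMeasure_holds`: apply this twice — first to the product of Haar
  probability measures on `SU(2)^E` (compact: `Matrix.specialUnitaryGroup.instCompactSpace` and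
  Tychonoff) with `φ = −(2g²)⁻¹ S_W`, the Wilson action `S_W` being continuous because the
  fundamental representation, multiplication and inversion of `SU(2)`, the trace and `Re` are
  (this is `wilsonWeight`), then to `wilsonWeight` with `φ = (α²/2) ∑ₑ Re tr U_e` (this is
  `su2HiggsWeight`); conclude with `ENNReal.inv_mul_cancel`.  (Same architecture as
  `isProbabilityMeasure_wilsonMeasure` in `LatticeGaugeProofs.lean`, which uses explicit trace
  bounds instead of compactness.)
-/

noncomputable section

open MeasureTheory Filter Topology
open scoped ENNReal
open Literature.MathematicalPhysics.QuantumLattice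

namespace Literature.MathematicalPhysics.QuantumFieldTheory

/-- On a compact space `X`, tilting a finite measure `μ` with `μ univ ≠ 0` by the density
`exp ∘ φ` of a continuous `φ : X → ℝ` gives a measure of positive finite total mass: with
`c ≤ φ ≤ C` (a continuous function on a compact space is bounded),
`e^{c} μ(univ) ≤ ∫ e^{φ} dμ ≤ e^{C} μ(univ)`. [folklore] -/
private theorem withDensity_exp_univ_ne_zero_and_ne_top {X : Type*} [MeasurableSpace X]
    [TopologicalSpace X] [CompactSpace X] (μ : Measure X) [IsFiniteMeasure μ]
    (hμ : μ Set.univ ≠ 0) {φ : X → ℝ} (hφ : Continuous φ) :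
    (μ.withDensity fun x => ENNReal.ofReal (Real.exp (φ x))) Set.univ ≠ 0 ∧
      (μ.withDensity fun x => ENNReal.ofReal (Real.exp (φ x))) Set.univ ≠ ∞ := by
  obtain ⟨C, hC⟩ := (isCompact_range hφ).bddAbove
  obtain ⟨c, hc⟩ := (isCompact_range hφ).bddBelow
  rw [withDensity_apply _ MeasurableSet.univ, Measure.restrict_univ]
  have hlow : ENNReal.ofReal (Real.exp c) * μ Set.univ ≤
      ∫⁻ x, ENNReal.ofReal (Real.exp (φ x)) ∂μ := by
    calc ENNReal.ofReal (Real.exp c) * μ Set.univ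
        = ∫⁻ _x, ENNReal.ofReal (Real.exp c) ∂μ := (lintegral_const _).symm
      _ ≤ ∫⁻ x, ENNReal.ofReal (Real.exp (φ x)) ∂μ :=
          lintegral_mono fun x => ENNReal.ofReal_le_ofReal
            (Real.exp_le_exp.2 (mem_lowerBounds.1 hc _ (Set.mem_range_self x)))
  have hup : ∫⁻ x, ENNReal.ofReal (Real.exp (φ x)) ∂μ ≤
      ENNReal.ofReal (Real.exp C) * μ Set.univ := by
    calc ∫⁻ x, ENNReal.ofReal (Real.exp (φ x)) ∂μ
        ≤ ∫⁻ _x, ENNReal.ofReal (Real.exp C) ∂μ :=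
          lintegral_mono fun x => ENNReal.ofReal_le_ofReal
            (Real.exp_le_exp.2 (mem_upperBounds.1 hC _ (Set.mem_range_self x)))
      _ = ENNReal.ofReal (Real.exp C) * μ Set.univ := lintegral_const _
  exact ⟨(lt_of_lt_of_le (ENNReal.mul_pos (ENNReal.ofReal_pos.2 (Real.exp_pos c)).ne' hμ) hlow).ne',
    ne_top_of_le_ne_top (ENNReal.mul_ne_top ENNReal.ofReal_ne_top (measure_ne_top μ _)) hup⟩

variable {d : ℕ}

/-- **Discharge of `isProbabilityMeasure_su2HiggsMeasure`.** For every `L ≥ 1` (`[NeZero L]`),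
every `g` and every `α`, the unitary-gauge `SU(2)` lattice Yang–Mills–Higgs measure
`su2HiggsMeasure L g α` on the torus `(ℤ/Lℤ)ᵈ` is a probability measure: the un-normalised weight
`su2HiggsWeight L g α` — product Haar measure on `SU(2)^E` tilted by
`exp (−(2g²)⁻¹ S_W(U))` (`wilsonWeight`) and then by `exp ((α²/2) ∑ₑ Re tr U_e)` — has continuous,
hence bounded above and below, log-density on the compact configuration space, so its total mass
`Z` satisfies `0 < Z < ∞` and `Z⁻¹ Z = 1`.  This is the (implicit) well-definedness of the
normalising constant in Chatterjee's model, §1.1/§1.4, in the unitary-gauge form of Lemma 5.4.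
[cite: arXiv240110507, §1.4 and Lemma 5.4] -/
theorem isProbabilityMeasure_su2HiggsMeasure_holds :
    isProbabilityMeasure_su2HiggsMeasure (d := d) := by
  intro L _ g α
  have hρ : Continuous (fundamentalRep (Fin 2)) := continuous_fundamentalRep (Fin 2)
  -- Step 1: the Wilson weight (product Haar tilted by `exp (-β S_W)`) has positive finite mass.
  have hS : Continuous fun U : GaugeConfig d L SU2 =>
      -(2 * g ^ 2)⁻¹ * wilsonAction (fundamentalRep (Fin 2)) U := by
    refine continuous_const.mul (continuous_finsetSum _ fun p _ => continuous_const.sub ?_)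
    refine Complex.continuous_re.comp (Continuous.matrix_trace (hρ.comp ?_))
    unfold plaquetteHolonomy
    fun_prop
  have h1 := withDensity_exp_univ_ne_zero_and_ne_top
    (Measure.pi fun _ : Edge d L => haarProbability SU2) (by rw [measure_univ]; exact one_ne_zero) hS
  haveI : IsFiniteMeasure (wilsonWeight (d := d) (L := L) (fundamentalRep (Fin 2)) (2 * g ^ 2)⁻¹) :=
    ⟨h1.2.lt_top⟩
  -- Step 2: tilt once more by the (continuous) Higgs edge term.
  have hE : Continuous fun U : GaugeConfig d L SU2 =>
      α ^ 2 / 2 * ∑ e : Edge d L, ((fundamentalRep (Fin 2) (U e)).trace).re :=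
    continuous_const.mul (continuous_finsetSum _ fun e _ =>
      Complex.continuous_re.comp (Continuous.matrix_trace (hρ.comp (continuous_apply e))))
  have h2 : su2HiggsWeight (d := d) L g α Set.univ ≠ 0 ∧ su2HiggsWeight (d := d) L g α Set.univ ≠ ∞ :=
    withDensity_exp_univ_ne_zero_and_ne_top
      (wilsonWeight (d := d) (L := L) (fundamentalRep (Fin 2)) (2 * g ^ 2)⁻¹) h1.1 hE
  constructor
  simp only [su2HiggsMeasure, Measure.smul_apply, smul_eq_mul]
  exact ENNReal.inv_mul_cancel h2.1 h2.2

end Literature.MathematicalPhysics.QuantumFieldTheory
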